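import Literature.NumberTheory.ModularForms.SiegelThetaCharacteristicOddActionSymmetricSix
import Literature.NumberTheory.ModularForms.ModularGroupAbelianization
import Literature.NumberTheory.ModularForms.SiegelModularFormsDegreeOne
import HarnessLib

/-!
# `SL₂(𝔽₂) ≅ S₃` through the action of `Γ₁` on the three even theta characteristics, and Reiner's `π⁻¹(A_3)`
# for `n = 1`; the even-characteristic action of `Γ_g` in general

F. Dalla Piazza, B. van Geemen, *Siegel modular forms and finite symplectic groups* (2009) [arXiv:0804.3769], §1.2
(held text `paper:arxiv-0804.3769`, p0004 L44–L49), verbatim: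
> One has the following description of `Sp(2g)` for small `g`: the action of `Sp(2)` on the three non-zero points
> in `𝔽₂² - {0}` induces an isomorphism `Sp(2) = SL(2, 𝔽₂) ≅ S_3`, the action of `Γ_4` on the six odd
> characteristics (for `g = 2`) induces an isomorphism `Sp(4) ≅ S_6` …
(p0004 L39: "`|Sp(2g)| = 6, 6! = 720, 36·(8!)` for `g = 1, 2, 3`"; p0020: "there are `3, 10, 36, 136` even
characteristics and `1, 6, 28, 120` odd characteristics for `g = 1, 2, 3, 4`".)

I. Reiner, *Real linear characters of the symplectic modular group*, Proc. AMS 6 (1955), §1: "it is known [4] that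
`Γ_{2n}/H ≅ S_{3n}` for `n = 1, 2` … `π⁻¹(A_{3n})` is a subgroup of index `2` of `Γ_{2n}`, `n = 1, 2`. Therefore
`Γ_{2n}` has a nontrivial real linear character for `n = 1, 2`, and the previous discussion shows that it is unique".

Lane `lit-hodgefound`, prover seat p25, row g33-#6; sequel of `SiegelThetaCharacteristicOddActionSymmetricSix.lean`
(g33-#5: `Sp₄(𝔽₂) ≅ S₆` on the odd characteristics), `SiegelThetaCharacteristicPermutationSign.lean` (g32-#9)
and `ModularGroupAbelianization.lean` (g33-#3: the character `χ_{η²}` of order `12` of `SL(2, ℤ)`). For `g = 1` the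
non-zero points of `𝔽₂²` are exactly the three EVEN characteristics `(0,0), (1,0), (0,1)` (`εδ = 0`; the fourth
characteristic `(1,1)` is the odd one), and the affine action of `Γ₁` on them is the printed action. Definitions
(reviewed): `EvenChar n`, `evenCharAction`, `evenCharActionModTwo`, `spTwoModTwoMulEquivPermEvenChar`,
`spTwoModTwoMulEquivPermFin`; no named fact.

## What is proved (namespace `Literature.NumberTheory.ModularForms`)

* §1 (every `g`) `EvenChar g`, **`evenCharAction : Sp_{2g}(ℤ) →* 𝔖(EvenChar g)`**; for `g = 2` the restatements
  `thetaCharacter_eq_sign_evenCharAction` (g32-#9: `v = sgn(γ|even)`) and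
  **`sign_evenCharAction_eq_sign_oddCharAction`** (`sgn(γ_M|even ten) = sgn(γ_M|odd six)` for every `M ∈ Γ₂`).
* §2 (`g = 1`) `card_evenChar_one = 3`; faithfulness modulo `2` (`ker_evenCharAction_eq_ker_reduceModTwo`: every
  characteristic of genus `1` is a sum of three even ones); surjectivity (the three transpositions are
  `γ_{n(1)}, γ_{v(1)}, γ_{n(1)v(1)n(1)}`, `decide`); **`spTwoModTwoMulEquivPermFin : Sp₂(ℤ/2) ≃* Equiv.Perm (Fin 3)`**,
  `card_symplecticGroup_fin_one_zmod_two = 6`, `index_ker_reduceModTwo_one = 6` (`[Γ₁ : Γ₁(2)] = 6`).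
* §3 (`g = 1`, Reiner's `π⁻¹(A_3)`) through the tree's `Γ₁ = Sp₂(ℤ) ≃* SL(2, ℤ)` (`symplecticGroupFinOneEquiv`):
  **`sign_evenCharAction_eq_etaSqCharacter_pow_six`** — the sign of the permutation of the three even
  characteristics is `χ_{η²}⁶` (both are characters of `SL(2, ℤ)` with value `-1` at `T`; g33-#3's
  `hom_ext_of_map_T_eq`); `index_comap_alternatingGroup_eq_two_fin_one` (`π⁻¹(A_3)` has index `2`);
  `mem_comap_alternatingGroup_iff_two_dvd_etaSqExp` (`π⁻¹(A_3) = {γ : 2 ∣ e(γ)}`, a subgroup between `Γ₁'`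
  (index `12`, g33-#3) and `Γ₁`).

## References

* [DallaPiazzaVanGeemen2009] F. Dalla Piazza, B. van Geemen, *Siegel modular forms and finite symplectic groups*,
  Adv. Theor. Math. Phys. 13 (2009), arXiv:0804.3769, §1.2 (p0004), Appendix A (p0020).
* [Reiner1955RealLinearCharacters] I. Reiner, Proc. Amer. Math. Soc. 6 (1955), 987–990, §1.
* [Klingen1990] H. Klingen, *Introductory Lectures on Siegel Modular Forms*, CUP (1990), §9 p. 111.
-/

noncomputable section

open Matrix
open scoped MatrixGroups
open Literature.Geometry.Kaehler.ComplexTorus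
open Literature.RepresentationTheory.HeisenbergGroup.SymplecticMatrix (unip coe_unip low coe_low levi coe_levi)

namespace Literature.NumberTheory.ModularForms

/-! ### §1 The even characteristics and the action of `Γ_g` on them -/

section EvenCharacteristics

variable {n : ℕ}

/-- **The even theta characteristics of genus `g`**: the `(ε, δ) ∈ (ℤ/2)^{2g}` with `Σᵢ εᵢδᵢ = 0` — "the even
characteristics which are those with `Σ aᵢbᵢ ≡ 0 mod 2`", `2^{g-1}(2^g+1)` of them.
[cite: DallaPiazzaVanGeemen2009, §1.2 (p0004 of the held text)] -/
abbrev EvenChar (n : ℕ) : Type :=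
  {q : Fin n ⊕ Fin n → ZMod 2 // ∑ i, q (Sum.inl i) * q (Sum.inr i) = 0}

/-- **The action of `Γ_g = Sp_{2g}(ℤ)` on the even characteristics** (restriction of the tree's `γ`, which preserves
the parity). [cite: DallaPiazzaVanGeemen2009, §1.2 (p0004 of the held text)] -/
def evenCharAction : Matrix.symplecticGroup (Fin n) ℤ →* Equiv.Perm (EvenChar n) where
  toFun M := (symplecticCharAction M).subtypePerm fun q => sum_mul_symplecticCharPerm_eq_zero_iff M.2 q
  map_one' := by
    ext q
    simp
  map_mul' M N := by
    ext q
    simp [Equiv.Perm.subtypePerm_apply]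

/-- Unfolding: `evenCharAction M` acts on an even characteristic by `γ_M`.
[cite: DallaPiazzaVanGeemen2009, §1.2 (p0004 of the held text)] -/
theorem evenCharAction_apply_coe (M : Matrix.symplecticGroup (Fin n) ℤ) (q : EvenChar n) :
    ((evenCharAction M q : EvenChar n) : Fin n ⊕ Fin n → ZMod 2) = symplecticCharAction M q := rfl

/-- **Klingen's `v` is the sign of `γ` on the ten even characteristics** (g32-#9, restated for the bundled
action). [cite: Klingen1990, §9 p. 111; §4 p. 59] -/
theorem thetaCharacter_eq_sign_evenCharAction (M : Matrix.symplecticGroup (Fin 2) ℤ) :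
    thetaCharacter M = ((Equiv.Perm.sign (evenCharAction M) : ℤˣ) : ℤ) :=
  thetaCharacter_eq_sign_symplecticCharAction M

/-- **`sgn(γ_M | ten even) = sgn(γ_M | six odd)`** for every `M ∈ Γ₂` (both signs are Klingen's `v(M)`).
[cite: Klingen1990, §4 p. 59 ("only one non-trivial character")] [cite: DallaPiazzaVanGeemen2009, §1.2 (p0004 of the held text)] -/
theorem sign_evenCharAction_eq_sign_oddCharAction (M : Matrix.symplecticGroup (Fin 2) ℤ) :
    Equiv.Perm.sign (evenCharAction M) = Equiv.Perm.sign (oddCharAction M) := by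
  have h := (thetaCharacter_eq_sign_evenCharAction M).symm.trans (thetaCharacter_eq_sign_oddCharAction M)
  exact Units.ext (by exact_mod_cast h)

end EvenCharacteristics

/-! ### §2 Genus one: `Γ₁` acts on the three even characteristics through `Sp₂(ℤ/2) ≅ S_3` -/

section GenusOne

/-- **There are three even characteristics in genus one** (`(0,0), (1,0), (0,1)`; `2^{g-1}(2^g+1) = 3`).
[cite: DallaPiazzaVanGeemen2009, §1.2 (p0004), Appendix A (p0020 of the held text)] -/
theorem card_evenChar_one : Fintype.card (EvenChar 1) = 3 := by
  decide

/-- Every characteristic of genus `1` is a sum of three even characteristics (a finite check). [folklore] -/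
private theorem exists_eq_even_add_even_add_even :
    ∀ p : Fin 1 ⊕ Fin 1 → ZMod 2, ∃ a b c : EvenChar 1,
      p = (a : Fin 1 ⊕ Fin 1 → ZMod 2) + (b : Fin 1 ⊕ Fin 1 → ZMod 2) + (c : Fin 1 ⊕ Fin 1 → ZMod 2) := by
  decide

/-- **Faithfulness on the even characteristics (`g = 1`)**: if `γ_M` fixes the three even characteristics it
fixes all four. [cite: DallaPiazzaVanGeemen2009, §1.2 (p0004 of the held text)] -/
theorem symplecticCharAction_eq_one_of_evenCharAction_eq_one (M : Matrix.symplecticGroup (Fin 1) ℤ)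
    (h : evenCharAction M = 1) : symplecticCharAction M = 1 := by
  have hfix : ∀ q : EvenChar 1, symplecticCharAction M q = q := fun q => by
    have := congrArg (fun σ : Equiv.Perm (EvenChar 1) => ((σ q : EvenChar 1) : Fin 1 ⊕ Fin 1 → ZMod 2)) h
    simpa [evenCharAction_apply_coe] using this
  ext p : 1
  obtain ⟨a, b, c, rfl⟩ := exists_eq_even_add_even_add_even p
  rw [symplecticCharAction_add_add, hfix a, hfix b, hfix c, Equiv.Perm.coe_one, id_eq]

/-- **The kernel of the action on the three even characteristics is `Γ₁(2)`.**
[cite: DallaPiazzaVanGeemen2009, §1.2–1.3 (p0004 of the held text)] -/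
theorem ker_evenCharAction_eq_ker_reduceModTwo : (evenCharAction (n := 1)).ker = (reduceModTwo 1).ker := by
  rw [← ker_symplecticCharAction_eq_ker_reduceModTwo]
  ext M
  simp only [MonoidHom.mem_ker]
  refine ⟨symplecticCharAction_eq_one_of_evenCharAction_eq_one M, fun h => Equiv.ext fun q => Subtype.ext ?_⟩
  change ((symplecticCharAction M) q : Fin 1 ⊕ Fin 1 → ZMod 2) = q
  rw [h, Equiv.Perm.coe_one, id_eq]

/-- `γ_M | even = γ_{M'} | even` iff `M ≡ M' (mod 2)` (`g = 1`). [cite: DallaPiazzaVanGeemen2009, §1.2 (p0004 of the held text)] -/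
theorem evenCharAction_eq_iff_reduceModTwo_eq (M M' : Matrix.symplecticGroup (Fin 1) ℤ) :
    evenCharAction M = evenCharAction M' ↔ reduceModTwo 1 M = reduceModTwo 1 M' := by
  rw [← inv_mul_eq_one, ← inv_mul_eq_one (a := reduceModTwo 1 M), ← map_inv, ← map_mul, ← map_inv, ← map_mul,
    ← MonoidHom.mem_ker, ← MonoidHom.mem_ker, ker_evenCharAction_eq_ker_reduceModTwo]

/-- `(1)` is a symmetric `1 × 1` matrix. [folklore] -/
private theorem isSymm_one_fin_one : (!![1] : Matrix (Fin 1) (Fin 1) ℤ).IsSymm := by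
  change (!![1] : Matrix (Fin 1) (Fin 1) ℤ)ᵀ = _; ext i j; fin_cases i; fin_cases j; rfl

/-- The translation `n(1) = T`. [folklore] -/
private def nOne : Matrix.symplecticGroup (Fin 1) ℤ := unip !![1] isSymm_one_fin_one
/-- The opposite translation `v(1)`. [folklore] -/
private def lOne : Matrix.symplecticGroup (Fin 1) ℤ := low !![1] isSymm_one_fin_one

/-- Three words realising the three transpositions of the even characteristics. [folklore] -/
private def transpositionWordsOne : List (Matrix.symplecticGroup (Fin 1) ℤ) := [nOne, lOne, nOne * lOne * nOne]

/-- **Every transposition of the three even characteristics is a `γ_M`** (kernel check).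
[cite: DallaPiazzaVanGeemen2009, §1.2 (p0004 of the held text)] -/
private theorem eq_or_exists_evenCharAction_eq_swap :
    ∀ x y : EvenChar 1, x = y ∨ ∃ M ∈ transpositionWordsOne, evenCharAction M = Equiv.swap x y := by
  decide

/-- **`n(1)` acts on the three even characteristics as a transposition.**
[cite: DallaPiazzaVanGeemen2009, §1.2, §8.5 (p0004, p0021 of the held text)] -/
theorem isSwap_evenCharAction_unip_one :
    (evenCharAction (unip (!![1] : Matrix (Fin 1) (Fin 1) ℤ) isSymm_one_fin_one)).IsSwap := by
  have h : ∃ x y : EvenChar 1, x ≠ y ∧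
      evenCharAction (unip (!![1] : Matrix (Fin 1) (Fin 1) ℤ) isSymm_one_fin_one) = Equiv.swap x y := by
    decide
  exact h

/-- **The action of `Γ₁` on the three even characteristics is onto `S_3`.**
[cite: DallaPiazzaVanGeemen2009, §1.2 (p0004 of the held text)] -/
theorem range_evenCharAction_eq_top : (evenCharAction (n := 1)).range = ⊤ := by
  rw [eq_top_iff, ← Equiv.Perm.closure_isSwap, Subgroup.closure_le]
  rintro σ ⟨x, y, hxy, rfl⟩
  rcases eq_or_exists_evenCharAction_eq_swap x y with h | ⟨M, -, hM⟩
  · exact absurd h hxy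
  · exact ⟨M, hM⟩

/-- Surjectivity, as a function statement. [cite: DallaPiazzaVanGeemen2009, §1.2 (p0004 of the held text)] -/
theorem evenCharAction_surjective : Function.Surjective (evenCharAction (n := 1)) :=
  MonoidHom.range_eq_top.1 range_evenCharAction_eq_top

/-- **The action of `Sp₂(ℤ/2) = Γ₁/Γ₁(2)` on the three even characteristics** (descent through reduction mod `2`).
[cite: DallaPiazzaVanGeemen2009, §1.2–1.3 (p0004 of the held text)] -/
def evenCharActionModTwo : Matrix.symplecticGroup (Fin 1) (ZMod 2) →* Equiv.Perm (EvenChar 1) :=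
  (reduceModTwo 1).liftOfSurjective reduceModTwo_surjective
    ⟨evenCharAction, ker_evenCharAction_eq_ker_reduceModTwo.symm.le⟩

/-- `evenCharActionModTwo (M mod 2) = evenCharAction M`. [cite: DallaPiazzaVanGeemen2009, §1.2 (p0004 of the held text)] -/
theorem evenCharActionModTwo_reduceModTwo (M : Matrix.symplecticGroup (Fin 1) ℤ) :
    evenCharActionModTwo (reduceModTwo 1 M) = evenCharAction M :=
  MonoidHom.liftOfRightInverse_comp_apply _ _ _ _ M

/-- `Sp₂(ℤ/2) → S_3` is a bijection. [cite: DallaPiazzaVanGeemen2009, §1.2 (p0004 of the held text)] -/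
theorem evenCharActionModTwo_bijective : Function.Bijective evenCharActionModTwo := by
  refine ⟨fun A B hAB => ?_, fun σ => ?_⟩
  · obtain ⟨a, rfl⟩ := reduceModTwo_surjective A
    obtain ⟨b, rfl⟩ := reduceModTwo_surjective B
    rw [evenCharActionModTwo_reduceModTwo, evenCharActionModTwo_reduceModTwo] at hAB
    exact (evenCharAction_eq_iff_reduceModTwo_eq a b).1 hAB
  · obtain ⟨M, rfl⟩ := evenCharAction_surjective σ
    exact ⟨reduceModTwo 1 M, evenCharActionModTwo_reduceModTwo M⟩

/-- **`Sp₂(ℤ/2) ≅ 𝔖(three even characteristics)`.** [cite: DallaPiazzaVanGeemen2009, §1.2 (p0004 of the held text)] -/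
def spTwoModTwoMulEquivPermEvenChar : Matrix.symplecticGroup (Fin 1) (ZMod 2) ≃* Equiv.Perm (EvenChar 1) :=
  MulEquiv.ofBijective evenCharActionModTwo evenCharActionModTwo_bijective

/-- Transport of permutations along a bijection, as a group isomorphism. [folklore] -/
private def permMulEquiv' {α β : Type*} (e : α ≃ β) : Equiv.Perm α ≃* Equiv.Perm β where
  toEquiv := e.permCongr
  map_mul' p q := by
    ext x
    simp [Equiv.permCongr_apply]

/-- **`Sp(2) = SL(2, 𝔽₂) ≅ S_3`** (Reiner's "`Γ_2/H ≅ S_3`").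
[cite: DallaPiazzaVanGeemen2009, §1.2 (p0004 of the held text)] [cite: Reiner1955RealLinearCharacters, §1] -/
def spTwoModTwoMulEquivPermFin : Matrix.symplecticGroup (Fin 1) (ZMod 2) ≃* Equiv.Perm (Fin 3) :=
  spTwoModTwoMulEquivPermEvenChar.trans (permMulEquiv' (Fintype.equivFinOfCardEq card_evenChar_one))

/-- **`|Sp₂(𝔽₂)| = 6`.** [cite: DallaPiazzaVanGeemen2009, §1.2 (p0004 L39 of the held text)] -/
theorem card_symplecticGroup_fin_one_zmod_two : Nat.card (Matrix.symplecticGroup (Fin 1) (ZMod 2)) = 6 := by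
  rw [Nat.card_congr spTwoModTwoMulEquivPermFin.toEquiv, Nat.card_eq_fintype_card, Fintype.card_perm,
    Fintype.card_fin]
  rfl

/-- **`[Γ₁ : Γ₁(2)] = 6`.** [cite: DallaPiazzaVanGeemen2009, §1.2–1.3 (p0004 of the held text)] -/
theorem index_ker_reduceModTwo_one : (reduceModTwo 1).ker.index = 6 := by
  rw [← ker_symplecticCharAction_eq_ker_reduceModTwo, index_ker_symplecticCharAction,
    card_symplecticGroup_fin_one_zmod_two]

end GenusOne

/-! ### §3 Genus one through `Γ₁ = Sp₂(ℤ) ≃* SL(2, ℤ)`: Reiner's `π⁻¹(A_3)` is the kernel of `χ_{η²}⁶` -/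

section ReinerGenusOne

open SiegelModularForm (symplecticGroupFinOneEquiv)
open SL2Z (etaSqCharacter etaSqCharacter_T hom_ext_of_map_T_eq etaSqCharacter_apply etaSqCharacter_eq_one_iff)
open Literature.NumberTheory.EllipticCurves.ModularForms (etaSqExp)

/-- The `ℂ`-valued character `γ ↦ sgn(π(γ))` of `SL(2, ℤ)`, `π` the action on the three even characteristics.
[folklore] -/
private def signEvenCharSL : SL(2, ℤ) →* ℂ :=
  (((Int.castRingHom ℂ).toMonoidHom.comp (Units.coeHom ℤ)).comp
    (Equiv.Perm.sign.comp (evenCharAction (n := 1)))).comp symplecticGroupFinOneEquiv.symm.toMonoidHom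

/-- Unfolding of `signEvenCharSL`. [folklore] -/
private theorem signEvenCharSL_apply (γ : SL(2, ℤ)) :
    signEvenCharSL γ = ((Equiv.Perm.sign (evenCharAction (symplecticGroupFinOneEquiv.symm γ)) : ℤˣ) : ℤ) := rfl

/-- `T = (1 1; 0 1)` permutes the three even characteristics by a transposition: `sgn(π(T)) = -1` (kernel check).
[folklore] -/
private theorem signEvenCharSL_T : signEvenCharSL ModularGroup.T = -1 := by
  have h : Equiv.Perm.sign (evenCharAction (symplecticGroupFinOneEquiv.symm ModularGroup.T)) = -1 := by
    decide
  rw [signEvenCharSL_apply, h]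
  norm_num

/-- `χ_{η²}(T)⁶ = e^{πi} = -1`. [folklore] -/
private theorem etaSqCharacter_T_pow_six : etaSqCharacter ModularGroup.T ^ 6 = -1 := by
  rw [etaSqCharacter_T, ← Complex.exp_nat_mul, show ((6 : ℕ) : ℂ) * (Real.pi * Complex.I / 6) = Real.pi * Complex.I
    by push_cast; ring, Complex.exp_pi_mul_I]

/-- **Reiner's real character for `n = 1` is `χ_{η²}⁶`**: the sign of the permutation of the three even
characteristics induced by `γ ∈ SL(2, ℤ) = Γ₁` equals `χ_{η²}(γ)⁶` (both are characters of `SL(2, ℤ)` taking the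
value `-1` at `T`, and a character of `SL(2, ℤ)` is determined by its value at `T`).
[cite: Reiner1955RealLinearCharacters, §1] -/
theorem sign_evenCharAction_eq_etaSqCharacter_pow_six (γ : SL(2, ℤ)) :
    (((Equiv.Perm.sign (evenCharAction (symplecticGroupFinOneEquiv.symm γ)) : ℤˣ) : ℤ) : ℂ) =
      etaSqCharacter γ ^ 6 := by
  have h : signEvenCharSL = etaSqCharacter ^ 6 :=
    hom_ext_of_map_T_eq _ _ (by rw [signEvenCharSL_T, MonoidHom.pow_apply, etaSqCharacter_T_pow_six])
  rw [← signEvenCharSL_apply, h, MonoidHom.pow_apply]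

/-- **`π⁻¹(A_3)` has index `2` in `Γ₁`** ("`π⁻¹(A_{3n})` is a subgroup of index `2` of `Γ_{2n}`, `n = 1`").
[cite: Reiner1955RealLinearCharacters, §1] -/
theorem index_comap_alternatingGroup_eq_two_fin_one :
    ((alternatingGroup (EvenChar 1)).comap (evenCharAction (n := 1))).index = 2 := by
  haveI : Nontrivial (EvenChar 1) := Fintype.one_lt_card_iff_nontrivial.1 (by rw [card_evenChar_one]; norm_num)
  rw [Subgroup.index_comap_of_surjective _ evenCharAction_surjective, alternatingGroup.index_eq_two]

/-- **`π⁻¹(A_3)` by congruences**: `γ = (a b; c d) ∈ SL(2, ℤ)` permutes the three even characteristics evenly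
iff `2 ∣ e(γ)`, `e` the exponent of `χ_{η²}` (so `π⁻¹(A_3) = ker χ_{η²}⁶ ⊋ Γ₁' = ker χ_{η²}`, of index `12`).
[cite: Reiner1955RealLinearCharacters, §1–§2] -/
theorem sign_evenCharAction_eq_one_iff_two_dvd_etaSqExp (γ : SL(2, ℤ)) :
    Equiv.Perm.sign (evenCharAction (symplecticGroupFinOneEquiv.symm γ)) = 1 ↔
      (2 : ℤ) ∣ etaSqExp (γ 0 0) (γ 0 1) (γ 1 0) (γ 1 1) := by
  have h6 : etaSqCharacter γ ^ 6 = etaSqCharacter (γ ^ 6) := (map_pow etaSqCharacter γ 6).symm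
  have key : Equiv.Perm.sign (evenCharAction (symplecticGroupFinOneEquiv.symm γ)) = 1 ↔
      etaSqCharacter γ ^ 6 = 1 := by
    rw [← sign_evenCharAction_eq_etaSqCharacter_pow_six]
    rcases Int.units_eq_one_or (Equiv.Perm.sign (evenCharAction (symplecticGroupFinOneEquiv.symm γ)))
      with h | h <;> rw [h] <;> norm_num
  have h2 : IsPrimitiveRoot (Complex.exp (Real.pi * Complex.I)) 2 := by
    have h := Complex.isPrimitiveRoot_exp 2 (by norm_num)
    rwa [show (2 * Real.pi * Complex.I / (2 : ℕ) : ℂ) = Real.pi * Complex.I by push_cast; ring] at h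
  rw [key, etaSqCharacter_apply, ← Complex.exp_nat_mul,
    show ((6 : ℕ) : ℂ) * (Real.pi * Complex.I / 6 * (etaSqExp (γ 0 0) (γ 0 1) (γ 1 0) (γ 1 1) : ℤ)) =
      (etaSqExp (γ 0 0) (γ 0 1) (γ 1 0) (γ 1 1) : ℤ) * (Real.pi * Complex.I) by push_cast; ring,
    Complex.exp_int_mul]
  exact_mod_cast h2.zpow_eq_one_iff_dvd _

end ReinerGenusOne

end Literature.NumberTheory.ModularForms

end
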